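import Summits.PneNP.PneNP.Theorems.ExpanderLinearGeneratorsSubstitutionBarriersPotential

/-!
# PneNP / ExpanderLinearGenerators — substitution barriers for the expansion-scale law, III:
# light cycles force the potential form (stmt-PneNP-11442, supports)

Companion of `…SubstitutionBarriers` (barrier I) and `…SubstitutionBarriersPotential`
(barrier II in potential form). Notation as there: target `A x = b` over `𝔽₂`, graph Tseitin
`B y = ch`, affine substitution `x ↦ M y + c` in consequence form `A M = P B`, `b + A c = P ch`.

The potential-form theorem assumed that the substitution matrix factors through the incidence
matrix, `M = N B`. This file derives that hypothesis from the KERNEL DISTANCE of the target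
(memo `memo-11442-s17-substitution-barriers.md`, Lemma B): for every cycle `z` of the host graph
(`B z = 0`) one has `A (M z) = P B z = 0`, so `M z` is a word of the kernel code `ker A`; if it is
lighter than the distance `D` of that code it vanishes. Hence if the cycle space `ker B` is
spanned by cycles `z` with `|M z| < D` ("light" — on the `k × k` grid: the unit squares, light as
soon as `4 · max_e |X_e| < D`), then `M` kills `ker B` and therefore factors as `M = N B`
(linear algebra over the field `𝔽₂`), and barrier II applies:

* `SubstitutionBarrier.mulVec_eq_zero_of_light` — a light kernel word of a cycle vanishes.
* `SubstitutionBarrier.exists_factor_of_ker_le` — `ker B ≤ ker M` gives `M = N B`.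
* `SubstitutionBarrier.exists_factor_of_light_cycles` — light spanning cycles give `M = N B`.
* `SubstitutionBarrier.lightCycles_exists_balanced_large_row` — **barrier II from kernel
  distance**: for a minimally unsolvable target whose kernel code has distance `D`, a connected
  host structure `B` and light spanning cycles, some variable is sent to the cut of a vertex set
  of size between `(|V| − w)/ℓ` and `|V|/2` — so the congestion of the substitution is at least
  the edge-isoperimetric value of the host graph at that size (`≥ 2k/√ℓ − O(√w)` on the grid),
  and two-sided expanders (`D = Θ(n)`) are out of reach of the technique (memo, Theorem E).

References: J. Krajíček, *Proof complexity* (CUP 2019), §13.4, Problem 19.4.5; J. Håstad,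
J. ACM 68 (2021); N. Galesi, D. Itsykson, A. Riazanov, A. Sofronova, APAL 174 (2023).
-/

namespace Summit.PneNP.PneNP.Theorems

set_option linter.dupNamespace false -- `Summit.PneNP.PneNP.…`: summit = sub-problem (D-0017)

open Finset Matrix

namespace SubstitutionBarrier

variable {ι κ V Eh : Type*}

/-- **Light kernel words vanish.** If `A M = P B`, `B z = 0` and the kernel code of `A` has
distance `D` (every nonzero `x` with `A x = 0` has weight `≥ D`), then `M z = 0` as soon as
`|M z| < D`. -/
theorem mulVec_eq_zero_of_light [Fintype κ] [Fintype V] [Fintype Eh]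
    (A : Matrix ι κ (ZMod 2)) (B : Matrix V Eh (ZMod 2)) (P : Matrix ι V (ZMod 2))
    (M : Matrix κ Eh (ZMod 2)) (D : ℕ) (hCF1 : A * M = P * B)
    (hD : ∀ x : κ → ZMod 2, A *ᵥ x = 0 → x ≠ 0 → D ≤ (univ.filter fun j => x j ≠ 0).card)
    (z : Eh → ZMod 2) (hz : B *ᵥ z = 0)
    (hlight : (univ.filter fun j => (M *ᵥ z) j ≠ 0).card < D) : M *ᵥ z = 0 := by
  by_contra hne
  have hker : A *ᵥ (M *ᵥ z) = 0 := by
    rw [Matrix.mulVec_mulVec, hCF1, ← Matrix.mulVec_mulVec, hz, Matrix.mulVec_zero]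
  have := hD _ hker hne
  omega

/-- **Factorisation through `B`.** Over the field `𝔽₂`, if every `y` with `B y = 0` has
`M y = 0`, then `M = N B` for some matrix `N` (factor `y ↦ M y` through the range of `y ↦ B y`
and extend the factor from that subspace to all of `V → 𝔽₂`). -/
theorem exists_factor_of_ker_le [Fintype V] [DecidableEq V] [Fintype Eh] [DecidableEq Eh]
    (B : Matrix V Eh (ZMod 2)) (M : Matrix κ Eh (ZMod 2))
    (hker : ∀ y : Eh → ZMod 2, B *ᵥ y = 0 → M *ᵥ y = 0) :
    ∃ N : Matrix κ V (ZMod 2), M = N * B := by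
  classical
  set f : (Eh → ZMod 2) →ₗ[ZMod 2] (V → ZMod 2) := Matrix.toLin' B with hf
  set g : (Eh → ZMod 2) →ₗ[ZMod 2] (κ → ZMod 2) := Matrix.toLin' M with hg
  have hle : LinearMap.ker f ≤ LinearMap.ker g := by
    intro y hy
    rw [LinearMap.mem_ker] at hy ⊢
    simp only [hf, hg, Matrix.toLin'_apply] at hy ⊢
    exact hker y hy
  -- factor through the quotient by `ker f`, identified with `range f`
  set g' : ((Eh → ZMod 2) ⧸ LinearMap.ker f) →ₗ[ZMod 2] (κ → ZMod 2) :=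
    (LinearMap.ker f).liftQ g hle with hg'
  set h₀ : LinearMap.range f →ₗ[ZMod 2] (κ → ZMod 2) :=
    g'.comp f.quotKerEquivRange.symm.toLinearMap with hh₀
  obtain ⟨h, hh⟩ := LinearMap.exists_extend h₀
  have hcomp : h.comp f = g := by
    refine LinearMap.ext fun y => ?_
    have hy : f y ∈ LinearMap.range f := LinearMap.mem_range_self f y
    have h1 : h (f y) = h₀ ⟨f y, hy⟩ := by
      have := LinearMap.congr_fun hh ⟨f y, hy⟩
      simpa using this
    rw [LinearMap.comp_apply, h1, hh₀, LinearMap.comp_apply]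
    simp only [LinearEquiv.coe_coe]
    rw [LinearMap.quotKerEquivRange_symm_apply_image f y hy, hg', Submodule.mkQ_apply,
      Submodule.liftQ_apply]
  refine ⟨LinearMap.toMatrix' h, ?_⟩
  apply Matrix.toLin'.injective
  rw [Matrix.toLin'_mul, Matrix.toLin'_toMatrix']
  exact hcomp.symm

/-- **Light spanning cycles give the potential form.** If `A M = P B`, the kernel code of `A`
has distance `D`, and `ker B` is spanned by a family of cycles `Z f` (`B (Z f) = 0`) each with
`|M (Z f)| < D`, then `M = N B` for some `N`. -/
theorem exists_factor_of_light_cycles [Fintype κ] [Fintype V] [DecidableEq V] [Fintype Eh]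
    [DecidableEq Eh] {F : Type*}
    (A : Matrix ι κ (ZMod 2)) (B : Matrix V Eh (ZMod 2)) (P : Matrix ι V (ZMod 2))
    (M : Matrix κ Eh (ZMod 2)) (D : ℕ) (hCF1 : A * M = P * B)
    (hD : ∀ x : κ → ZMod 2, A *ᵥ x = 0 → x ≠ 0 → D ≤ (univ.filter fun j => x j ≠ 0).card)
    (Z : F → (Eh → ZMod 2)) (hZ : ∀ f, B *ᵥ Z f = 0)
    (hspan : ∀ y : Eh → ZMod 2, B *ᵥ y = 0 → y ∈ Submodule.span (ZMod 2) (Set.range Z))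
    (hlight : ∀ f, (univ.filter fun j => (M *ᵥ Z f) j ≠ 0).card < D) :
    ∃ N : Matrix κ V (ZMod 2), M = N * B := by
  classical
  have hzero : ∀ f, M *ᵥ Z f = 0 := fun f =>
    mulVec_eq_zero_of_light A B P M D hCF1 hD (Z f) (hZ f) (hlight f)
  -- `y ↦ M y` is linear and kills the spanning family, hence kills the span
  have hspan0 : ∀ x ∈ Submodule.span (ZMod 2) (Set.range Z), M *ᵥ x = 0 := by
    intro x hx
    induction hx using Submodule.span_induction with
    | mem x hx =>
        obtain ⟨f, rfl⟩ := hx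
        exact hzero f
    | zero => exact Matrix.mulVec_zero M
    | add x y _ _ hx hy => rw [Matrix.mulVec_add, hx, hy, add_zero]
    | smul a x _ hx => rw [Matrix.mulVec_smul, hx, smul_zero]
  exact exists_factor_of_ker_le B M fun y hy => hspan0 y (hspan y hy)

/-- **Barrier II from kernel distance.** Consequence form `A M = P B`, `b + A c = P ch` for a
MINIMALLY UNSOLVABLE target (`𝟙ᵀ A = 0`, `𝟙ᵀ b = 1`) with rows of weight `≤ ℓ`, rows of `P` of
weight `≤ w < |V|`, odd total charge, a "connected" host structure `B` (`d ᵥ* B = 0 →` `d`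
constant; `𝟙 ᵥ* B = 0`), a kernel code of distance `D`, and `ker B` spanned by cycles `Z f` that
are light (`|M (Z f)| < D`). Then the substitution is in potential form `M = N' B` with every row
of `N'` supported on at most half of `V` and some row supported on at least `(|V| − w)/ℓ`
vertices: that variable `x_j` is sent to the parity of ALL edges of a balanced cut of the host
graph (on the `k × k` grid with light unit squares: at least `min(2√((k² − w)/ℓ), k)` edge
variables). -/
theorem lightCycles_exists_balanced_large_row [Fintype ι] [Fintype κ] [Fintype V]
    [DecidableEq V] [Fintype Eh] [DecidableEq Eh] {F : Type*}
    (A : Matrix ι κ (ZMod 2)) (b : ι → ZMod 2) (c : κ → ZMod 2) (B : Matrix V Eh (ZMod 2))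
    (ch : V → ZMod 2) (P : Matrix ι V (ZMod 2)) (M : Matrix κ Eh (ZMod 2)) (ℓ w D : ℕ)
    (hA : ∀ j, ∑ i, A i j = 0) (hb : ∑ i, b i = 1) (hch : ∑ u, ch u = 1)
    (hconn : ∀ d : V → ZMod 2, d ᵥ* B = 0 → ∀ u v, d u = d v)
    (hBcol : ∀ e, ∑ u, B u e = 0)
    (hCF1 : A * M = P * B) (hCF2 : b + A *ᵥ c = P *ᵥ ch)
    (hrow : ∀ i, (univ.filter fun j => A i j ≠ 0).card ≤ ℓ)
    (hW : ∀ i, (univ.filter fun u => P i u ≠ 0).card ≤ w)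
    (hV : w < Fintype.card V)
    (hD : ∀ x : κ → ZMod 2, A *ᵥ x = 0 → x ≠ 0 → D ≤ (univ.filter fun j => x j ≠ 0).card)
    (Z : F → (Eh → ZMod 2)) (hZ : ∀ f, B *ᵥ Z f = 0)
    (hspan : ∀ y : Eh → ZMod 2, B *ᵥ y = 0 → y ∈ Submodule.span (ZMod 2) (Set.range Z))
    (hlight : ∀ f, (univ.filter fun j => (M *ᵥ Z f) j ≠ 0).card < D) :
    ∃ N' : Matrix κ V (ZMod 2), N' * B = M ∧
      (∀ j, 2 * (univ.filter fun u => N' j u ≠ 0).card ≤ Fintype.card V) ∧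
      ∃ j, Fintype.card V ≤ ℓ * (univ.filter fun u => N' j u ≠ 0).card + w := by
  obtain ⟨N, hN⟩ := exists_factor_of_light_cycles A B P M D hCF1 hD Z hZ hspan hlight
  have hCF1' : A * N * B = P * B := by rw [Matrix.mul_assoc, ← hN, hCF1]
  obtain ⟨N', hN'B, hhalf, hlarge⟩ :=
    potentialForm_exists_balanced_large_row A b c B ch P N ℓ w hA hb hch hconn hBcol hCF1' hCF2
      hrow hW hV
  exact ⟨N', by rw [hN'B, hN], hhalf, hlarge⟩

end SubstitutionBarrier

end Summit.PneNP.PneNP.Theorems
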